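import Summits.ABC.IUTFork.Repair.RHReachLedgerQ2AbcRecut
import Summits.ABC.IUTFork.Repair.RHReachLedgerQ2Genuine
import HarnessLib

/-!
# R-H ROUND 2 Q2(27) — THE R14 RECUT of row 27's EXPLICIT-4 road to abc: `HStar27OnSigma27 ∧ certificates|Σ₂₇ ∧ NUM ∧ CONE-cut ⟹ ABC`
# over p477080's `k2Target27_of_certificates`, with the cone binder `hregBad` (Szpiro-bad locus) / `hregC` (content locus, R14′) instead of `hreg`

PROOF-ONLY file (0 definitions, 0 `Prop` facts, no instance, no notation; abc-iut cell, D-0079 RESCUE sub-cell R-H, rung LADDER-ABC:A2.RESCUE.H;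
pair n = 10 typer abc-iut-rh-typ-10; sibling of `Repair/RHReachLedgerQ2AbcRecut.lean`, which carries the R14 record and the recut composites
`abc_of_k2Target27_of_hStar27OnSigma27_hregBad` / `…_content_hregC`). TAKES NO SIDE on [IUTchIII] Cor. 3.12 / [IUTchIV] Thm. 1.10 or on any author
(Mochizuki / Scholze–Stix / Joshi / Dupuy–Hilado); typed ≠ proved; instantiated ≠ endorsed; nothing here asserts abc proved or refuted.

abc-iut-rh-ref-3 (2026-08-27T00:23:41Z) recorded that «the EXPLICIT-4 road to abc, `abc_of_k2Target27_of_hStar27OnSigma27` (p468994) [∘ p477080's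
`k2Target27_of_certificates`], passes the BLANKET `hreg`» — VACUOUS AS TYPED in [CONE] by abc-iut-s2-p5's `Conditional.not_hreg_v4` (RULING R14).
This file writes that road over the guarded cone binders of record, in every context of abc-iut-c312-7's sharp `K`-setting (the families
`M, archPk, …, qData` are BINDERS, as in p477080):
* `abc_of_hStar27OnSigma27_of_certificates_hregBad` — H⋆₂₇|Σ₂₇ (`HStar27OnSigma27`, p468994) · the certified uniform dictionary at every Σ₂₇ datum
  (p477080's ONE hypothesis VERBATIM: `e(𝔭_x ∣ p) = e_p`, inner / outer witnesses per place, `innerCond ≤ A_p ∧ B_p ≤ rOutSharp` at the bad places)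
  · NUM(deep ∧ bad) · CONE-bad `hregBad` (abc-iut-s2-p2's binder VERBATIM) ⟹ `ABC`. Explicit 4 = H⋆₂₇(Σ₂₇) · CERT(Σ₂₇) · NUM(deep ∧ bad) · CONE(Szpiro-bad).
* `abc_of_hStar27OnSigma27_of_certificates_content_hregC` — the θ-cut twin: NUM(deep ∧ content) · CONE-C `hregC` (abc-iut-C-cert-1's binders VERBATIM).
Both are one-line compositions `k2Target27_of_certificates ∘ abc_of_k2Target27_of_hStar27OnSigma27_{hregBad, content_hregC}`.
HONEST SCOPE. The certificate hypothesis is NOT discharged here (uniformity of `e` over each fibre: `K/ℚ` Galois rows; witnesses: off the inner /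
outer ties — abc-iut-rh2-L1's `RHReachLedgerRealiseLocal` lineage removes the good primes and the untied bad primes from it); H⋆₂₇ and the
certificates are HYPOTHESIS SHAPES over OUR typed objects (Dupuy–Hilado (Ind2) = all `ℤ_p`-lattice automorphisms, STRONGER-THAN-PRINT; SHARP boxes;
volume reading of Step (xi)); `hregBad` / `hregC` are assumption labels, neither proved nor refuted as typed; which genuine data satisfy H⋆₂₇ is
rh-num-1's table (k1 74.8 % pooled / 98.9 % on frey Szpiro-bad ∧ window), not a theorem.
[cite: Mochizuki2012, IUTchI Ex. 3.2 (iv) p. 71; IUTchIII Cor. 3.12 p. 173–174; IUTchIV Thm. 1.10 p. 22–23, Step (viii) p. 30; Cor. 2.2 (ii) p. 46]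
[cite: DupuyHilado2025, §1 (1.1), §3.4, §3.9, §4.9] [claim: Mochizuki2012, status: disputed] for every IUT sentence quoted. Axioms: standard.
-/

noncomputable section

open Set Function NumberField IsDedekindDomain

namespace Summit.ABC.IUTFork.Repair.RH.ReachLedgerQ2

open Thm311 Thm311.Real Cor312 Cor312Vol Cor312Prov Literature.IUT.LogThetaLattice Literature.IUT.LogVolume
  Literature.IUT.HodgeTheaters Literature.IUT.LogVolume.ThetaData Summit.ABC.IUTFork.Repair.RH.ReachLedger
open Literature.NumberTheory.DiophantineGeometry Literature.NumberTheory.DiophantineGeometry.GenEll Summit.ABC.ABC.Theorems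
  Summit.ABC.IUTFork.Conditional
open scoped Classical

section KFamily

variable
    (M : ∀ (P : NFPoint) (l : ℕ) (T : Cor22.ThetaVolumeDatumAt P l), Type) [∀ P l T, Field (M P l T)] [∀ P l T, NumberField (M P l T)]
    (archPk : ∀ (P : NFPoint) (l : ℕ) (T : Cor22.ThetaVolumeDatumAt P l), letI := T.instFieldF; letI := T.instNumberFieldF; letI := T.instAlgebraF; letI := T.instFieldK;
        letI := T.instNumberFieldK; letI := T.instAlgebraK; letI := T.instFieldFbar; letI := T.instAlgebraFbar;
        letI := T.instAlgebraKFbar; letI := T.instIsElliptic;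
      ∀ (j : (thetaIndex (pilotDataOfK T.D T.K)).Label) (vQ : (thetaIndex (pilotDataOfK T.D T.K)).VQ), Set ((logShellsDH (pilotDataOfK T.D T.K) (analyticLogv T.K)).Packet j vQ))
    (archSub : ∀ (P : NFPoint) (l : ℕ) (T : Cor22.ThetaVolumeDatumAt P l), letI := T.instFieldF; letI := T.instNumberFieldF; letI := T.instAlgebraF; letI := T.instFieldK;
        letI := T.instNumberFieldK; letI := T.instAlgebraK; letI := T.instFieldFbar; letI := T.instAlgebraFbar;
        letI := T.instAlgebraKFbar; letI := T.instIsElliptic;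
      ∀ (j : (thetaIndex (pilotDataOfK T.D T.K)).Label) (v : (thetaIndex (pilotDataOfK T.D T.K)).V), Set ((logShellsDH (pilotDataOfK T.D T.K) (analyticLogv T.K)).Packet j ((thetaIndex (pilotDataOfK T.D T.K)).over v)))
    (Ψ : ∀ (P : NFPoint) (l : ℕ) (T : Cor22.ThetaVolumeDatumAt P l), letI := T.instFieldF; letI := T.instNumberFieldF; letI := T.instAlgebraF; letI := T.instFieldK;
        letI := T.instNumberFieldK; letI := T.instAlgebraK; letI := T.instFieldFbar; letI := T.instAlgebraFbar;
        letI := T.instAlgebraKFbar; letI := T.instIsElliptic;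
      ℤ → ∀ v : (thetaIndex (pilotDataOfK T.D T.K)).V, v ∈ (thetaIndex (pilotDataOfK T.D T.K)).Vbad → Set ((logShellsDH (pilotDataOfK T.D T.K) (analyticLogv T.K)).StarPacket v))
    (act : ∀ (P : NFPoint) (l : ℕ) (T : Cor22.ThetaVolumeDatumAt P l), letI := T.instFieldF; letI := T.instNumberFieldF; letI := T.instAlgebraF; letI := T.instFieldK;
        letI := T.instNumberFieldK; letI := T.instAlgebraK; letI := T.instFieldFbar; letI := T.instAlgebraFbar;
        letI := T.instAlgebraKFbar; letI := T.instIsElliptic;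
      ℤ → ∀ v : (thetaIndex (pilotDataOfK T.D T.K)).V, v ∈ (thetaIndex (pilotDataOfK T.D T.K)).Vbad → (logShellsDH (pilotDataOfK T.D T.K) (analyticLogv T.K)).StarPacket v → Module.End ℚ ((logShellsDH (pilotDataOfK T.D T.K) (analyticLogv T.K)).StarPacket v))
    (Mmod : ∀ (P : NFPoint) (l : ℕ) (T : Cor22.ThetaVolumeDatumAt P l), letI := T.instFieldF; letI := T.instNumberFieldF; letI := T.instAlgebraF; letI := T.instFieldK;
        letI := T.instNumberFieldK; letI := T.instAlgebraK; letI := T.instFieldFbar; letI := T.instAlgebraFbar;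
        letI := T.instAlgebraKFbar; letI := T.instIsElliptic;
      ℤ → ∀ j : (thetaIndex (pilotDataOfK T.D T.K)).LabelStar, Set ((logShellsDH (pilotDataOfK T.D T.K) (analyticLogv T.K)).GlobalPacket j.1))
    (region : ∀ (P : NFPoint) (l : ℕ) (T : Cor22.ThetaVolumeDatumAt P l), letI := T.instFieldF; letI := T.instNumberFieldF; letI := T.instAlgebraF; letI := T.instFieldK;
        letI := T.instNumberFieldK; letI := T.instAlgebraK; letI := T.instFieldFbar; letI := T.instAlgebraFbar;
        letI := T.instAlgebraKFbar; letI := T.instIsElliptic;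
      ℤ → ∀ j : (thetaIndex (pilotDataOfK T.D T.K)).LabelStar, FinDivisor (M P l T) → ∀ vQ : (thetaIndex (pilotDataOfK T.D T.K)).VQ, Set ((logShellsDH (pilotDataOfK T.D T.K) (analyticLogv T.K)).Packet j.1 vQ))
    (n : ∀ (P : NFPoint) (l : ℕ) (T : Cor22.ThetaVolumeDatumAt P l), ℤ)
    {HT : ∀ (P : NFPoint) (l : ℕ) (T : Cor22.ThetaVolumeDatumAt P l), Type} {LogLink : ∀ (P : NFPoint) (l : ℕ) (T : Cor22.ThetaVolumeDatumAt P l), HT P l T → HT P l T → Type}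
    {IsFull : ∀ (P : NFPoint) (l : ℕ) (T : Cor22.ThetaVolumeDatumAt P l), ∀ {s t : HT P l T}, LogLink P l T s t → Prop}
    (lat : ∀ (P : NFPoint) (l : ℕ) (T : Cor22.ThetaVolumeDatumAt P l), LGPGaussianLogThetaLattice (LogLink P l T) (IsFull P l T))
    {Frd : ∀ (P : NFPoint) (l : ℕ) (T : Cor22.ThetaVolumeDatumAt P l), Type} {IsoF : ∀ (P : NFPoint) (l : ℕ) (T : Cor22.ThetaVolumeDatumAt P l), Frd P l T → Frd P l T → Type} {Ob : ∀ (P : NFPoint) (l : ℕ) (T : Cor22.ThetaVolumeDatumAt P l), Frd P l T → Type}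
    {realify : ∀ (P : NFPoint) (l : ℕ) (T : Cor22.ThetaVolumeDatumAt P l), Frd P l T → Frd P l T} {Strip : ∀ (P : NFPoint) (l : ℕ) (T : Cor22.ThetaVolumeDatumAt P l), Type} {IsoS : ∀ (P : NFPoint) (l : ℕ) (T : Cor22.ThetaVolumeDatumAt P l), Strip P l T → Strip P l T → Type}
    {Mv : ∀ (P : NFPoint) (l : ℕ) (T : Cor22.ThetaVolumeDatumAt P l), letI := T.instFieldF; letI := T.instNumberFieldF; letI := T.instAlgebraF; letI := T.instFieldK;
        letI := T.instNumberFieldK; letI := T.instAlgebraK; letI := T.instFieldFbar; letI := T.instAlgebraFbar;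
        letI := T.instAlgebraKFbar; letI := T.instIsElliptic;
      ∀ v : (thetaIndex (pilotDataOfK T.D T.K)).V, v ∈ (thetaIndex (pilotDataOfK T.D T.K)).Vbad → Type}
    [∀ P l T v h, Monoid (Mv P l T v h)]
    (sig : ∀ (P : NFPoint) (l : ℕ) (T : Cor22.ThetaVolumeDatumAt P l), letI := T.instFieldF; letI := T.instNumberFieldF; letI := T.instAlgebraF; letI := T.instFieldK;
        letI := T.instNumberFieldK; letI := T.instAlgebraK; letI := T.instFieldFbar; letI := T.instAlgebraFbar;
        letI := T.instAlgebraKFbar; letI := T.instIsElliptic;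
      GlobalLGPFrobenioidSignature (thetaIndex (pilotDataOfK T.D T.K)).lstar (thetaIndex (pilotDataOfK T.D T.K)).V (· ∈ (thetaIndex (pilotDataOfK T.D T.K)).Vbad) (Frd P l T) (IsoF P l T) (Ob P l T) (realify P l T)
        (Strip P l T) (IsoS P l T) (Mv P l T))
    (split : ∀ (P : NFPoint) (l : ℕ) (T : Cor22.ThetaVolumeDatumAt P l), SplittingMonoids (Mv P l T))
    {ObΔ : ∀ (P : NFPoint) (l : ℕ) (T : Cor22.ThetaVolumeDatumAt P l), Type} {N : ∀ (P : NFPoint) (l : ℕ) (T : Cor22.ThetaVolumeDatumAt P l), letI := T.instFieldF; letI := T.instNumberFieldF; letI := T.instAlgebraF; letI := T.instFieldK;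
        letI := T.instNumberFieldK; letI := T.instAlgebraK; letI := T.instFieldFbar; letI := T.instAlgebraFbar;
        letI := T.instAlgebraKFbar; letI := T.instIsElliptic;
      ∀ v : (thetaIndex (pilotDataOfK T.D T.K)).V, v ∈ (thetaIndex (pilotDataOfK T.D T.K)).Vbad → Type}
    [∀ P l T v h, Monoid (N P l T v h)] (qData : ∀ (P : NFPoint) (l : ℕ) (T : Cor22.ThetaVolumeDatumAt P l), QPilotData (ObΔ P l T) (N P l T))

include M archPk archSub Ψ act Mmod region n lat sig split qData in
/-- **EXPLICIT-4 RECUT OF ROW 27's CHAIN: `HStar27OnSigma27 ∧ certified uniform dictionary|Σ₂₇ ∧ NUM(deep ∧ bad) ∧ CONE-bad ⟹ ABC`** (every context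
of abc-iut-c312-7's sharp `K`-setting, as binders). p477080's `k2Target27_of_certificates` (first arrow from ONE hypothesis: every Σ₂₇ datum carries
a certified uniform dictionary `(e_p, A_p, B_p)` — `e(𝔭_x ∣ p) = e_p`, inner/outer witnesses per place, `innerCond ≤ A_p ∧ B_p ≤ rOutSharp` at the bad
places) ∘ `abc_of_k2Target27_of_hStar27OnSigma27_hregBad`. Explicit 4 = H⋆₂₇(Σ₂₇) · CERT(Σ₂₇) · NUM(deep ∧ bad) · CONE(Szpiro-bad); the certificate
hypothesis is NOT discharged here (uniformity: `K/ℚ` Galois rows; witnesses: off the inner/outer ties — abc-iut-rh2-L1's lineage); H⋆₂₇ and the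
certificates are HYPOTHESES; `hregBad` is an assumption label; nothing asserted; no side taken on [IUTchIII] Cor. 3.12.
[cite: Mochizuki2012, IUTchI Ex. 3.2 (iv) p. 71; IUTchIII Cor. 3.12 p. 173–174; IUTchIV Cor. 2.2 (ii) p. 46] [cite: DupuyHilado2025, §1 (1.1), §3.4, §3.9, §4.9]
[claim: Mochizuki2012, status: disputed] -/
theorem abc_of_hStar27OnSigma27_of_certificates_hregBad (hS : HStar27OnSigma27)
    (hcert : ∀ (P : NFPoint), P ∈ UP → ∀ (l : ℕ), l.Prime → 5 ≤ l →
      Cor22.AdmitsCore P → Cor22.CondP2 P l → Cor22.CondP5 P l → Cor22.CondP6 P l →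
      (((l : ℝ) + 5) / 4 < (Cor22.dmod P : ℝ) ∨
        6 * l * (((l : ℝ) + 5) - 4 * Cor22.dmod P) / (((l : ℝ) + 4) * ((l : ℝ) - 3))
            * (P.logDiff + (1 - 1 / (l : ℝ)) * Cor22.logCondAvoid P {2, l})
          + 6 * l * ((l : ℝ) + 5) / (((l : ℝ) + 4) * ((l : ℝ) - 3)) * Real.log Real.pi < Cor22.logQAvoid P {2, l}) →
      ∀ (T : Cor22.ThetaVolumeDatumAt P l), letI := T.instFieldF; letI := T.instNumberFieldF; letI := T.instAlgebraF; letI := T.instFieldK;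
        letI := T.instNumberFieldK; letI := T.instAlgebraK; letI := T.instFieldFbar; letI := T.instAlgebraFbar;
        letI := T.instAlgebraKFbar; letI := T.instIsElliptic;
      ¬ (∃ (pp : Nat.Primes) (_ : 2 < (pp : ℕ)) (i : Fin (thetaIndex (pilotDataOfK T.D T.K)).lstar)
          (x₀ : (thetaIndex (pilotDataOfK T.D T.K)).Fibre (.inr pp)),
        haveI : Fact (pp : ℕ).Prime := ⟨pp.2⟩
        ((pp : ℕ) : ℝ) ^ ((((i : ℕ) : ℝ) + 2) * (4 + 2 * Real.logb (pp : ℕ) (Module.finrank ℚ T.K)) + 1) *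
          ‖(exists_realising_qIdeles_pilotDataOfK T.D).choose pp x₀‖ ^ (((i : ℕ) + 1) ^ 2 - 1) < 1) →
      ∃ (eK AK : Nat.Primes → ℕ) (BK : Nat.Primes → ℤ), (∀ pp, BK pp ≤ (AK pp : ℤ)) ∧
        ∀ (pp : Nat.Primes) (x : (thetaIndex (pilotDataOfK T.D T.K)).Fibre (.inr pp)), haveI : Fact (pp : ℕ).Prime := ⟨pp.2⟩
          (placeOf (pilotDataOfK T.D T.K) pp.1 x).asIdeal.ramificationIdx ℤ = eK pp ∧
          (∃ u : kOf (pilotDataOfK T.D T.K) pp.1 x,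
            ‖u‖ ≤ (pp : ℝ) ^ (-(((AK pp : ℤ) - 1 : ℤ) : ℝ) / (eK pp : ℝ)) ∧
              u ∉ (logUnits (kOf (pilotDataOfK T.D T.K) pp.1 x) : Set (kOf (pilotDataOfK T.D T.K) pp.1 x))) ∧
          (∃ z ∈ (logUnits (kOf (pilotDataOfK T.D T.K) pp.1 x) : Set (kOf (pilotDataOfK T.D T.K) pp.1 x)),
            ((pp : ℕ) : ℝ) ^ (-(BK pp : ℝ) / (eK pp : ℝ)) ≤ ‖z‖) ∧
          (placeOf (pilotDataOfK T.D T.K) pp.1 x ∈ (pilotDataOfK T.D T.K).S →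
            innerCond pp (eK pp) ≤ (AK pp : ℤ) ∧ BK pp ≤ rOutSharp pp (eK pp)))
    (hNumBad : ∀ (P : NFPoint), P ∈ UP → ∀ (l : ℕ), l.Prime → 5 ≤ l →
      Cor22.AdmitsCore P → Cor22.CondP2 P l → Cor22.CondP5 P l → Cor22.CondP6 P l →
      -- ONLY at SZPIRO-BAD `(P, l)`: elsewhere `T.Cor312Of` is the theorem `Cor22.ThetaVolumeDatumAt.cor312Of_of_szpiro` (abc-iut-c312-d1)
      (((l : ℝ) + 5) / 4 < (Cor22.dmod P : ℝ) ∨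
        6 * l * (((l : ℝ) + 5) - 4 * Cor22.dmod P) / (((l : ℝ) + 4) * ((l : ℝ) - 3))
            * (P.logDiff + (1 - 1 / (l : ℝ)) * Cor22.logCondAvoid P {2, l})
          + 6 * l * ((l : ℝ) + 5) / (((l : ℝ) + 4) * ((l : ℝ) - 3)) * Real.log Real.pi < Cor22.logQAvoid P {2, l}) →
      ∀ (T : Cor22.ThetaVolumeDatumAt P l), letI := T.instFieldF; letI := T.instNumberFieldF; letI := T.instAlgebraF; letI := T.instFieldK;
        letI := T.instNumberFieldK; letI := T.instAlgebraK; letI := T.instFieldFbar; letI := T.instAlgebraFbar;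
        letI := T.instAlgebraKFbar; letI := T.instIsElliptic;
      (∃ (pp : Nat.Primes) (_ : 2 < (pp : ℕ)) (i : Fin (thetaIndex (pilotDataOfK T.D T.K)).lstar)
          (x₀ : (thetaIndex (pilotDataOfK T.D T.K)).Fibre (.inr pp)),
        haveI : Fact (pp : ℕ).Prime := ⟨pp.2⟩
        ((pp : ℕ) : ℝ) ^ ((((i : ℕ) : ℝ) + 2) * (4 + 2 * Real.logb (pp : ℕ) (Module.finrank ℚ T.K)) + 1) *
          ‖(exists_realising_qIdeles_pilotDataOfK T.D).choose pp x₀‖ ^ (((i : ℕ) + 1) ^ 2 - 1) < 1) → T.Cor312Of)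
    -- [CONE, Szpiro-bad] the off-regime hull estimate with print's constant `B_III(P,l)`, demanded ONLY at SZPIRO-BAD admissible `(P, l)`
    (hregBad : ∀ P : NFPoint, P ∈ UP → ∀ l : ℕ, l.Prime → 5 ≤ l →
      Cor22.AdmitsCore P → Cor22.CondP2 P l → Cor22.CondP5 P l → Cor22.CondP6 P l →
      (((l : ℝ) + 5) / 4 < (Cor22.dmod P : ℝ) ∨
        6 * l * (((l : ℝ) + 5) - 4 * Cor22.dmod P) / (((l : ℝ) + 4) * ((l : ℝ) - 3))
            * (P.logDiff + (1 - 1 / (l : ℝ)) * Cor22.logCondAvoid P {2, l})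
          + 6 * l * ((l : ℝ) + 5) / (((l : ℝ) + 4) * ((l : ℝ) - 3)) * Real.log Real.pi < Cor22.logQAvoid P {2, l}) →
      ∀ T : Cor22.ThetaVolumeDatumAt P l,
        (letI := T.instFieldF; letI := T.instNumberFieldF; letI := T.instAlgebraF; letI := T.instFieldK
         letI := T.instNumberFieldK; letI := T.instAlgebraK; letI := T.instFieldFbar; letI := T.instAlgebraFbar
         letI := T.instAlgebraKFbar; letI := T.instIsElliptic
         ¬ (∀ p ∈ T.I.supportPrimes, ∀ v w : placesOver (fieldOfModuli T.E) p,
            (Summit.ABC.IUTFork.DHData.ofInput T.I).logQloc p v = (Summit.ABC.IUTFork.DHData.ofInput T.I).logQloc p w)) →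
        T.HullEstimateOf
          (((l : ℝ) + 1) / 4 *
            ((1 + 12 * (Cor22.dmod P : ℝ) / l) * (P.logDiff + Cor22.logCondAvoid P {2, l})
              + 2 * Real.log l + 52
              + 20 / 3 * Real.log (((2 ^ 12 * 3 ^ 3 * 5 * Cor22.dmod P : ℕ) : ℝ) * (l : ℝ))
                * (Nat.primeCounting (2 ^ 12 * 3 ^ 3 * 5 * Cor22.dmod P * l) : ℝ))))
    : _root_.ABC :=
  abc_of_k2Target27_of_hStar27OnSigma27_hregBad
    (k2Target27_of_certificates M archPk archSub Ψ act Mmod region n lat sig split qData hcert) hS hNumBad hregBad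

include M archPk archSub Ψ act Mmod region n lat sig split qData in
/-- **EXPLICIT-4 RECUT, θ-cut twin: `HStar27OnSigma27 ∧ certified uniform dictionary|Σ₂₇ ∧ NUM(deep ∧ content) ∧ CONE-C ⟹ ABC`** (R14′ content
line; `hNumC` / `hregC` abc-iut-C-cert-1's binders VERBATIM). p477080's `k2Target27_of_certificates` ∘ `abc_of_k2Target27_of_hStar27OnSigma27_content_hregC`.
The certificate hypothesis is NOT discharged here; H⋆₂₇ and the certificates are HYPOTHESES; nothing asserted; no side taken on [IUTchIII] Cor. 3.12.
[cite: Mochizuki2012, IUTchIII Cor. 3.12 p. 173–174; IUTchIV Thm. 1.10 Step (viii) p. 30] [cite: DupuyHilado2025, §1 (1.1), §3.9]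
[claim: Mochizuki2012, status: disputed] -/
theorem abc_of_hStar27OnSigma27_of_certificates_content_hregC (hS : HStar27OnSigma27)
    (hcert : ∀ (P : NFPoint), P ∈ UP → ∀ (l : ℕ), l.Prime → 5 ≤ l →
      Cor22.AdmitsCore P → Cor22.CondP2 P l → Cor22.CondP5 P l → Cor22.CondP6 P l →
      (((l : ℝ) + 5) / 4 < (Cor22.dmod P : ℝ) ∨
        6 * l * (((l : ℝ) + 5) - 4 * Cor22.dmod P) / (((l : ℝ) + 4) * ((l : ℝ) - 3))
            * (P.logDiff + (1 - 1 / (l : ℝ)) * Cor22.logCondAvoid P {2, l})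
          + 6 * l * ((l : ℝ) + 5) / (((l : ℝ) + 4) * ((l : ℝ) - 3)) * Real.log Real.pi < Cor22.logQAvoid P {2, l}) →
      ∀ (T : Cor22.ThetaVolumeDatumAt P l), letI := T.instFieldF; letI := T.instNumberFieldF; letI := T.instAlgebraF; letI := T.instFieldK;
        letI := T.instNumberFieldK; letI := T.instAlgebraK; letI := T.instFieldFbar; letI := T.instAlgebraFbar;
        letI := T.instAlgebraKFbar; letI := T.instIsElliptic;
      ¬ (∃ (pp : Nat.Primes) (_ : 2 < (pp : ℕ)) (i : Fin (thetaIndex (pilotDataOfK T.D T.K)).lstar)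
          (x₀ : (thetaIndex (pilotDataOfK T.D T.K)).Fibre (.inr pp)),
        haveI : Fact (pp : ℕ).Prime := ⟨pp.2⟩
        ((pp : ℕ) : ℝ) ^ ((((i : ℕ) : ℝ) + 2) * (4 + 2 * Real.logb (pp : ℕ) (Module.finrank ℚ T.K)) + 1) *
          ‖(exists_realising_qIdeles_pilotDataOfK T.D).choose pp x₀‖ ^ (((i : ℕ) + 1) ^ 2 - 1) < 1) →
      ∃ (eK AK : Nat.Primes → ℕ) (BK : Nat.Primes → ℤ), (∀ pp, BK pp ≤ (AK pp : ℤ)) ∧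
        ∀ (pp : Nat.Primes) (x : (thetaIndex (pilotDataOfK T.D T.K)).Fibre (.inr pp)), haveI : Fact (pp : ℕ).Prime := ⟨pp.2⟩
          (placeOf (pilotDataOfK T.D T.K) pp.1 x).asIdeal.ramificationIdx ℤ = eK pp ∧
          (∃ u : kOf (pilotDataOfK T.D T.K) pp.1 x,
            ‖u‖ ≤ (pp : ℝ) ^ (-(((AK pp : ℤ) - 1 : ℤ) : ℝ) / (eK pp : ℝ)) ∧
              u ∉ (logUnits (kOf (pilotDataOfK T.D T.K) pp.1 x) : Set (kOf (pilotDataOfK T.D T.K) pp.1 x))) ∧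
          (∃ z ∈ (logUnits (kOf (pilotDataOfK T.D T.K) pp.1 x) : Set (kOf (pilotDataOfK T.D T.K) pp.1 x)),
            ((pp : ℕ) : ℝ) ^ (-(BK pp : ℝ) / (eK pp : ℝ)) ≤ ‖z‖) ∧
          (placeOf (pilotDataOfK T.D T.K) pp.1 x ∈ (pilotDataOfK T.D T.K).S →
            innerCond pp (eK pp) ≤ (AK pp : ℤ) ∧ BK pp ≤ rOutSharp pp (eK pp)))
    -- [NUM, DEEP ∧ CONTENT] the NUMBER-level Corollary 3.12, ONLY at admissible data ON the depth locus of points ON the content locus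
    (hNumC : ∀ (P : NFPoint), P ∈ UP → ∀ (l : ℕ), l.Prime → 5 ≤ l →
      Cor22.AdmitsCore P → Cor22.CondP2 P l → Cor22.CondP5 P l → Cor22.CondP6 P l →
      -- ONLY on the CONTENT LOCUS of [IUTchIV] Thm. 1.10's display (`display_of_not_content`: off it the display holds for every `η > 0`)
      6 * ((1 + 20 * (Cor22.dmod P : ℝ) / l) * (P.logDiff + Cor22.logCondAvoid P {2, l}))
          + 120 * (2 ^ 12 * 3 ^ 3 * 5 * (Cor22.dmod P : ℝ) * l) < Cor22.logQAvoid P {2, l} →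
      ∀ (T : Cor22.ThetaVolumeDatumAt P l), letI := T.instFieldF; letI := T.instNumberFieldF; letI := T.instAlgebraF; letI := T.instFieldK;
        letI := T.instNumberFieldK; letI := T.instAlgebraK; letI := T.instFieldFbar; letI := T.instAlgebraFbar;
        letI := T.instAlgebraKFbar; letI := T.instIsElliptic;
      (∃ (pp : Nat.Primes) (_ : 2 < (pp : ℕ)) (i : Fin (thetaIndex (pilotDataOfK T.D T.K)).lstar)
          (x₀ : (thetaIndex (pilotDataOfK T.D T.K)).Fibre (.inr pp)),
        haveI : Fact (pp : ℕ).Prime := ⟨pp.2⟩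
        ((pp : ℕ) : ℝ) ^ ((((i : ℕ) : ℝ) + 2) * (4 + 2 * Real.logb (pp : ℕ) (Module.finrank ℚ T.K)) + 1) *
          ‖(exists_realising_qIdeles_pilotDataOfK T.D).choose pp x₀‖ ^ (((i : ℕ) + 1) ^ 2 - 1) < 1) → T.Cor312Of)
    -- [CONE, CONTENT] the hull estimate with print's `B_III(P,l)` off the slot-constant regime, ONLY at admissible points ON the content locus
    (hregC : ∀ P : NFPoint, P ∈ UP → ∀ l : ℕ, l.Prime → 5 ≤ l →
      Cor22.AdmitsCore P → Cor22.CondP2 P l → Cor22.CondP5 P l → Cor22.CondP6 P l →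
      6 * ((1 + 20 * (Cor22.dmod P : ℝ) / l) * (P.logDiff + Cor22.logCondAvoid P {2, l}))
          + 120 * (2 ^ 12 * 3 ^ 3 * 5 * (Cor22.dmod P : ℝ) * l) < Cor22.logQAvoid P {2, l} →
      ∀ T : Cor22.ThetaVolumeDatumAt P l,
        (letI := T.instFieldF; letI := T.instNumberFieldF; letI := T.instAlgebraF; letI := T.instFieldK
         letI := T.instNumberFieldK; letI := T.instAlgebraK; letI := T.instFieldFbar; letI := T.instAlgebraFbar
         letI := T.instAlgebraKFbar; letI := T.instIsElliptic
         ¬ (∀ p ∈ T.I.supportPrimes, ∀ v w : placesOver (fieldOfModuli T.E) p,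
            (Summit.ABC.IUTFork.DHData.ofInput T.I).logQloc p v = (Summit.ABC.IUTFork.DHData.ofInput T.I).logQloc p w)) →
        T.HullEstimateOf
          (((l : ℝ) + 1) / 4 *
            ((1 + 12 * (Cor22.dmod P : ℝ) / l) * (P.logDiff + Cor22.logCondAvoid P {2, l})
              + 2 * Real.log l + 52
              + 20 / 3 * Real.log (((2 ^ 12 * 3 ^ 3 * 5 * Cor22.dmod P : ℕ) : ℝ) * (l : ℝ))
                * (Nat.primeCounting (2 ^ 12 * 3 ^ 3 * 5 * Cor22.dmod P * l) : ℝ))))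
    : _root_.ABC :=
  abc_of_k2Target27_of_hStar27OnSigma27_content_hregC
    (k2Target27_of_certificates M archPk archSub Ψ act Mmod region n lat sig split qData hcert) hS hNumC hregC

end KFamily

end Summit.ABC.IUTFork.Repair.RH.ReachLedgerQ2

end
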